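import Summits.QuantumFields.BalabanUV.Beta.FP.PerfectObjectsT

/-!
# `BalabanUV.Beta.FP.EndpointOfRoad` — road «FP» for binder row D1: the cell's END STATEMENT `EndpointExistence Cn` (B12 Thm 2, first sentence /
# B16 p.355 reading) BY TYPE from road FP's two sequence hypotheses about the perfect coefficient family + (CONV-C-Cauchy) + the scale-wise
# dictionary `hβ` + (D4) + (C) + generation — the composition `FP/PerfectObjectsT.d1Drift_JsBalOf_of_perfect_step_law_bounded` ∘
# `OneStepKernelFamily.endpointExistence_of_D1Drift`, nothing else

HONEST FRAMING (cell contract, verbatim): «discharging `BetaPertH` makes Bałaban's UV stability UNCONDITIONAL — a real constructive-QFT result;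
it is NOT the continuum limit and NOT the Clay problem.»  THIS MODULE DISCHARGES NOTHING: every binder below is a HYPOTHESIS (row G-an2-4: (CONV-C-Cauchy);
road FP leaves N2/N6 (STEP) and N7 (ASYMP); row D4: `RemainderConst` + `rr ≤ stepBal`; (C) `BetaContH`; the dictionary `hβ`; generation `hgen`).  It is the
road-FP twin of asym1-g27's scratch certificate `endpointExistence_of_rows_W_D1_D4_C` (journal 2026-08-20T05:31:27Z) with that certificate's `hId` binder
REPLACED by the two sequence properties of `fPerf` — the point of road FP.  NOT BetaPertH, NOT continuum, NOT Clay.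
ABSOLUTE RULE (cell, verbatim): «No internally-minted statement may enter as a cited fact. Every hypothesis is either kernel-proved in this package or a
verbatim quotation of a PUBLISHED theorem with page reference.»  Nothing is cited; no `def`; no binder instantiated at a value.
-/

namespace Summit.QuantumFields.BalabanUV.Beta.FP.EndpointOfRoad

open Filter Topology
open Literature.MathematicalPhysics.QuantumFieldTheory.Balaban1983to89
open Literature.MathematicalPhysics.QuantumFieldTheory.Balaban1983to89.Beta
open FlowStep FlowStepRuns DagBinding
open ExpKernelCalculus (MKer Decays VertexFamily₂ hessKer)
open OneStepResolventKernel (Fib LocStencil)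
open OneStepKernelFamily (KInvStep TbalOf D1Drift endpointExistence_of_D1Drift)
open BalabanStepJetsSucc (JsBal0Of JsBalOf)
open B12Normalization (stepBal)
open Literature.MathematicalPhysics.QuantumFieldTheory.Balaban1983to89.Beta.RemainderChain (RemainderConst)
open Summit.QuantumFields.BalabanUV.Beta.HessKerDressedUnits (unitK unitS unitW)
open Summit.QuantumFields.BalabanUV.Beta.FP.PerfectObjectsT (KPerf SPerfOf WPerfOf fPerf d1Drift_JsBalOf_of_perfect_step_law_bounded
  d1Drift_JsBalOf_of_perfect_step_law_littleO)

variable {Lc : ℕ} [NeZero Lc] (hLc : 1 ≤ Lc) (cE cVH cΛ : ℝ)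
  (W : ℕ → Fin (3 + 1) → (Fin (3 + 1) → ℤ) → Fin (3 + 1) → (Fin (3 + 1) → ℤ) → MKer (3 + 1) (Fib 3))
  (Cw' δw : ℕ → ℝ) (hδw : ∀ j, 0 < δw j) (hW' : ∀ j, VertexFamily₂ (W j) Lc (Cw' j) (δw j))
  (sf sm : ℕ → ℝ)
  (S : ℕ → ℕ → Fin (3 + 1) → (Fin (3 + 1) → ℤ) → MKer (3 + 1) (Fib 3))
  (Wt : ℕ → ℕ → Fin (3 + 1) → (Fin (3 + 1) → ℤ) → Fin (3 + 1) → (Fin (3 + 1) → ℤ) → MKer (3 + 1) (Fib 3))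
  {R C cK δK Cs cS δS Cw cW δW θ : ℝ}

/-- **THE CELL's END STATEMENT FROM ROAD FP (bounded-defect form).**  For the wall family `JsBalOf …` of a construction `Cn` generated forward by the
β-functions `β` with split `Sβ` whose one-loop coefficients ARE the typed second moments (`hβ`): (CONV-C-Cauchy) in limit currency at the perfect
triple [row G-an2-4] + the perfect family's STEP LAW [leaf N2/N6] + its bounded-defect LOG ASYMPTOTICS [leaf N7] + (D4) `RemainderConst Sβ γ₀ rr`,
`rr ≤ stepBal N Lc` + (C) `BetaContH γ₀ β` ⊢ `EndpointExistence Cn`.  Composition only; discharges nothing. -/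
theorem endpointExistence_of_perfect_step_law_bounded (hsf : ∀ j, sf j ≠ 0) (hsm : ∀ j, sm j ≠ 0)
    (hS1 : ∀ j, S j 1 = (JsBal0Of hLc cE cVH cΛ W Cw' δw hδw hW' j).S) (hW1 : ∀ j, Wt j 1 = W j)
    (hK : ∀ j, Decays (unitK (sf j) (sm j) (KInvStep (d := 3) Lc j)) C δK) (hKinf : Decays (KPerf (d := 3) Lc sf sm 1) C δK)
    (hKrate : ∀ j, Decays (unitK (sf j) (sm j) (KInvStep (d := 3) Lc j) - KPerf (d := 3) Lc sf sm 1) (cK * θ ^ j) δK)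
    (hS : ∀ j, LocStencil (unitS (sf j) (sm j) (JsBal0Of hLc cE cVH cΛ W Cw' δw hδw hW' j).S) Cs δS) (hSinf : LocStencil (SPerfOf sf sm S 1) Cs δS)
    (hSrate : ∀ j, LocStencil (unitS (sf j) (sm j) (JsBal0Of hLc cE cVH cΛ W Cw' δw hδw hW' j).S - SPerfOf sf sm S 1) (cS * θ ^ j) δS)
    (hW : ∀ j, VertexFamily₂ (unitW (sf j) (sm j) (W j)) Lc Cw δW) (hWinf : VertexFamily₂ (WPerfOf sf sm Wt 1) Lc Cw δW)
    (hWrate : ∀ j, VertexFamily₂ (unitW (sf j) (sm j) (W j) - WPerfOf sf sm Wt 1) Lc (cW * θ ^ j) δW)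
    (hR : 0 < R) (hRK : R < δK) (hRS : R / 2 < δS) (hRW : R < δW) (hθ0 : 0 ≤ θ) (hθ1 : θ < 1) (μ ν : Fin 4) {N Cg : ℝ}
    (hstep : ∀ m : ℕ, 1 ≤ m → fPerf Lc sf sm S Wt μ ν (m + 1) = fPerf Lc sf sm S Wt μ ν m + fPerf Lc sf sm S Wt μ ν 1)
    (hasym : ∀ m : ℕ, 1 ≤ m → |fPerf Lc sf sm S Wt μ ν m - (m : ℝ) * stepBal N Lc| ≤ Cg)
    {β : HBeta} {Cn : B12.Construction} (hgen : ForwardGenerated Cn β) (Sβ : B12Beta.OneLoopSplit β)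
    (hβ : ∀ j, Sβ.β0 j = B12Beta.secondMoment (TbalOf Lc (JsBalOf hLc cE cVH cΛ W Cw' δw hδw hW') j) μ ν)
    {rr γ₀ : ℝ} (hγ₀ : 0 < γ₀) (hrem : RemainderConst Sβ γ₀ rr) (hr : rr ≤ stepBal N Lc) (hcont : BetaContH γ₀ β) :
    EndpointExistence Cn :=
  endpointExistence_of_D1Drift hgen Sβ (JsBalOf hLc cE cVH cΛ W Cw' δw hδw hW') hβ
    (d1Drift_JsBalOf_of_perfect_step_law_bounded hLc cE cVH cΛ W Cw' δw hδw hW' sf sm S Wt hsf hsm hS1 hW1 hK hKinf hKrate hS hSinf hSrate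
      hW hWinf hWrate hR hRK hRS hRW hθ0 hθ1 μ ν hstep hasym)
    hγ₀ hrem hr hcont

/-- **THE CELL's END STATEMENT FROM ROAD FP (mean-law form)**: as above with the asymptotic input weakened to `(fPerf m − m·stepBal N Lc)/m → 0`. -/
theorem endpointExistence_of_perfect_step_law_littleO (hsf : ∀ j, sf j ≠ 0) (hsm : ∀ j, sm j ≠ 0)
    (hS1 : ∀ j, S j 1 = (JsBal0Of hLc cE cVH cΛ W Cw' δw hδw hW' j).S) (hW1 : ∀ j, Wt j 1 = W j)
    (hK : ∀ j, Decays (unitK (sf j) (sm j) (KInvStep (d := 3) Lc j)) C δK) (hKinf : Decays (KPerf (d := 3) Lc sf sm 1) C δK)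
    (hKrate : ∀ j, Decays (unitK (sf j) (sm j) (KInvStep (d := 3) Lc j) - KPerf (d := 3) Lc sf sm 1) (cK * θ ^ j) δK)
    (hS : ∀ j, LocStencil (unitS (sf j) (sm j) (JsBal0Of hLc cE cVH cΛ W Cw' δw hδw hW' j).S) Cs δS) (hSinf : LocStencil (SPerfOf sf sm S 1) Cs δS)
    (hSrate : ∀ j, LocStencil (unitS (sf j) (sm j) (JsBal0Of hLc cE cVH cΛ W Cw' δw hδw hW' j).S - SPerfOf sf sm S 1) (cS * θ ^ j) δS)
    (hW : ∀ j, VertexFamily₂ (unitW (sf j) (sm j) (W j)) Lc Cw δW) (hWinf : VertexFamily₂ (WPerfOf sf sm Wt 1) Lc Cw δW)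
    (hWrate : ∀ j, VertexFamily₂ (unitW (sf j) (sm j) (W j) - WPerfOf sf sm Wt 1) Lc (cW * θ ^ j) δW)
    (hR : 0 < R) (hRK : R < δK) (hRS : R / 2 < δS) (hRW : R < δW) (hθ0 : 0 ≤ θ) (hθ1 : θ < 1) (μ ν : Fin 4) {N : ℝ}
    (hstep : ∀ m : ℕ, 1 ≤ m → fPerf Lc sf sm S Wt μ ν (m + 1) = fPerf Lc sf sm S Wt μ ν m + fPerf Lc sf sm S Wt μ ν 1)
    (hasym : Tendsto (fun m : ℕ => (fPerf Lc sf sm S Wt μ ν m - (m : ℝ) * stepBal N Lc) / (m : ℝ)) atTop (𝓝 0))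
    {β : HBeta} {Cn : B12.Construction} (hgen : ForwardGenerated Cn β) (Sβ : B12Beta.OneLoopSplit β)
    (hβ : ∀ j, Sβ.β0 j = B12Beta.secondMoment (TbalOf Lc (JsBalOf hLc cE cVH cΛ W Cw' δw hδw hW') j) μ ν)
    {rr γ₀ : ℝ} (hγ₀ : 0 < γ₀) (hrem : RemainderConst Sβ γ₀ rr) (hr : rr ≤ stepBal N Lc) (hcont : BetaContH γ₀ β) :
    EndpointExistence Cn :=
  endpointExistence_of_D1Drift hgen Sβ (JsBalOf hLc cE cVH cΛ W Cw' δw hδw hW') hβ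
    (d1Drift_JsBalOf_of_perfect_step_law_littleO hLc cE cVH cΛ W Cw' δw hδw hW' sf sm S Wt hsf hsm hS1 hW1 hK hKinf hKrate hS hSinf hSrate
      hW hWinf hWrate hR hRK hRS hRW hθ0 hθ1 μ ν hstep hasym)
    hγ₀ hrem hr hcont

end Summit.QuantumFields.BalabanUV.Beta.FP.EndpointOfRoad
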